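import Literature.Geometry.Kaehler.ComplexTorusHodgeGroupProductLieKernels
import Literature.Geometry.Kaehler.ComplexTorusLieAlgebraSemisimpleDefinedOverQ
import Literature.Geometry.Kaehler.ComplexTorusHodgeLieAlgebraRatFunctoriality
import Literature.Geometry.Kaehler.ComplexTorusHodgeLieAlgebraRatReductive
import HarnessLib

/-!
# The Goursat position of the RATIONAL Hodge Lie algebra `𝒜(X₁ × X₂) ⊆ 𝒜(X₁) ⊕ 𝒜(X₂)` (Moonen–Zarhin (3.1) over `ℚ`):
# the block projections `𝒜(X₁ × X₂) → 𝒜(Xᵢ)` are ONTO over `ℚ`, the Goursat ideals `𝔤ᵢ = Lie Kᵢ` are defined over `ℚ`,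
# `𝒜(X₁) ⧸ 𝔤₁ ≅ 𝒜(X₂) ⧸ 𝔤₂` as `ℚ`-Lie algebras, and `𝒜(X₁ × X₂) = 𝒜(X₁) ⊕ 𝒜(X₂) ⟺ Hg(X₁ × X₂) = Hg(X₁) × Hg(X₂)`

Layer `Literature/Geometry/Kaehler`, namespace `Literature.Geometry.Kaehler.ComplexTorus`; lane `lit-hodgefound` (Track 2
foundations library), Layer A3/A4; prover seat `lit-hodgefound-p17` (generation 42, self-proposed row g42-#1 = the gen-41
free pointer 2 «`ℚ`-forms of the gen-41 dictionary»).  THEOREMS ONLY (no definition, no instance, no notation, no named fact;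
D-0026 net debt 0).

DICTIONARY.  `X = X₁ × X₂ = prodPeriod Φ₁ Φ₂`; `𝒜(X) = hodgeGroupLieRat (prodPeriod Φ₁ Φ₂) ⊆ 𝔤𝔩(ℚ^{ι₁ ⊕ ι₂})` is the Hodge
Lie algebra OVER `ℚ` of p36's `ComplexTorusHodgeLieAlgebraRatForm` (Green–Griffiths–Kerr's `𝒜`; `𝔥𝔤_ℝ = 𝒜 ⊗ ℝ`,
`Lie Hg(X)(ℂ) = 𝒜 ⊗ ℂ`); `G = Hg(X)(ℂ)`, `Gᵢ = Hg(Xᵢ)(ℂ)` and the kernels `K₁ = hodgeGroupCProdInl`, `K₂ = hodgeGroupCProdInr` of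
the block projections, with their algebraic Lie algebras `Lie Kᵢ = lieAlgebraGL (Kᵢ ↪ GL)`; `· ⊗ 1` is the entrywise cast
`A ↦ A.map (↑) : M(ℚ) → M(ℂ)` and `W ⊗_ℚ ℂ = span_ℂ (W ⊗ 1)`.

What was known: `𝒜(X₁ × X₂) ⊆ 𝒜(X₁) ⊕ 𝒜(X₂)` block-diagonally (`ComplexTorusHodgeLieAlgebraRatFunctoriality`, p36 g18-#10 —
its docstring lists «NOT here: surjectivity of the projections `𝒜(X₁ × X₂) → 𝒜(X_i)` (needs Lie algebras of images of
algebraic-group morphisms); `𝒜(X₁ × X₂) = 𝒜(X₁) ⊕ 𝒜(X₂)` criteria»), and the whole Goursat dictionary OVER `ℂ` for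
`Lie Hg(X₁ × X₂)(ℂ)` (p17 g40-#7 `ComplexTorusHodgeGroupProductLieAlgebraGoursat`: `exists_lieHom_toBlocks`, onto; g41-#5
`ComplexTorusHodgeGroupProductLieKernels`: kernels `= Lie Kᵢ`, Goursat isomorphism, dimensions).  THIS FILE DESCENDS IT TO `ℚ`
through p36's base-change engine for matrix Lie algebras defined over `ℚ` (`ComplexTorusLieAlgebra{Centers,Centralizers,Semisimple}DefinedOverQ`:
«the rational points of `W ⊗ ℂ` are `W`», Bourbaki's `X = Σ λ_k (x_k ⊗ 1)` with `λ_k` independent over `ℚ`).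

## Sources, verbatim

* [MoonenZarhin1999LowDim] B. Moonen, Yu. G. Zarhin, *Hodge classes on abelian varieties of low dimension*, Math. Ann. 315
  (1999), §3 (3.1) (held `paper:arxiv-math_9901113` p0006 L24–L45): «`Hg(X)` is an algebraic subgroup of `Hg(X₁) × Hg(X₂)`.
  The two projections `prᵢ : Hg(X) → Hg(Xᵢ)` are surjective. From this one easily shows that there exist Lie algebras `𝔤₁`,
  `𝔤₂`, `𝔤₃` and an automorphism `φ` of `𝔤₃` such that `𝔥𝔤(X₁) ≅ 𝔤₁ ⊕ 𝔤₃`, `𝔥𝔤(X₂) ≅ 𝔤₂ ⊕ 𝔤₃`, and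
  `𝔥𝔤(X₁ × X₂) ≅ 𝔤₁ ⊕ 𝔤₂ ⊕ Γ_φ`.» — there `𝔥𝔤` is the Lie algebra of the `ℚ`-group `Hg`, a Lie algebra OVER `ℚ`; §3 Lemma
  (3.6), proof (p0007 L25–L28): «noting that `𝔤₁` and `𝔤₃` are algebraic Lie subalgebras of `𝔥𝔤(X)`» (defined over `ℚ`).
* [GreenGriffithsKerr2012] M. Green, P. Griffiths, M. Kerr, *Mumford–Tate Groups and Domains* (2012), §II.C, Lemma after
  (II.C.1) («`𝒜 ⊂ 𝔤` … it is defined over `ℚ` so that `𝒜_ℂ = 𝒜 ⊗ ℂ`») and §III.B (i) (p. 72: «`M_{φ₁+φ₂} ⊂ M_{φ₁} × M_{φ₂}`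
  […] the inclusions (i), (ii) are in general not isomorphisms»).
* [Gordon1997] B. B. Gordon, *A survey of the Hodge conjecture for abelian varieties* (alg-geom/9709030), §2.16 Proposition
  (Goursat's Lemma; held p0012 L112–L125).
* [Springer1998] T. A. Springer, *Linear Algebraic Groups*, 2nd ed., §11.1.1 (a), (e) and §11.1.2 (a) («If `f` is defined
  over `F` then `Ker f` and `Im f` are defined over `F`»); 4.4.5–4.4.7 (Lie algebras of algebraic groups, dimension).
* [Bourbaki1989LieGroups13] N. Bourbaki, *Lie Groups and Lie Algebras, Chapters 1–3*, Ch. I §3 no. 8 (extension of the base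
  field: «we may write `x' = Σ λ_i x_i` … `λ_i` linearly independent over `K`»).
* [Hazama1983] F. Hazama, Tôhoku Math. J. 35 (1983), Lemma (3.1) (the dimension form of Goursat).

## What is proved (arbitrary complex tori `X₁`, `X₂`; no polarisation anywhere)

* §1 `mem_hodgeGroupLieRat_iff_map_ratCast_mem_lieAlgebraGL` (`A ∈ 𝒜(X) ⟺ A ⊗ 1 ∈ Lie Hg(X)(ℂ)`, every torus),
  `coe_lieAlgebraGL_hodgeGroupC_eq_span_hodgeGroupLieRat` (`Lie Hg(X)(ℂ) = 𝒜 ⊗ ℂ` for the algebraic Lie algebra),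
  `finrank_hodgeGroupLieRat_eq_zdim` (`dim_ℚ 𝒜(X) = dim Hg(X)`).
* §2 **SURJECTIVITY OVER `ℚ`**: `exists_mem_hodgeGroupLieRat_prod_toBlocks₁₁_eq` / `…toBlocks₂₂_eq` (every `A ∈ 𝒜(X₁)` is the
  block `C₁₁` of some `C ∈ 𝒜(X₁ × X₂)`, and likewise for `X₂`), `image_toBlocks₁₁_hodgeGroupLieRat_prod` / `…₂₂…` (as set
  identities), **`exists_lieHom_toBlocks_rat`** (THE GOURSAT POSITION OVER `ℚ`: `r₁ : 𝒜(X) → 𝒜(X₁)`, `r₂ : 𝒜(X) → 𝒜(X₂)`,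
  `C ↦ C₁₁`, `C ↦ C₂₂`, Lie homomorphisms over `ℚ`, both onto, `ker r₁ ⊓ ker r₂ = 0`).
* §3 **THE GOURSAT IDEALS ARE DEFINED OVER `ℚ`**: `fromBlocks_zero_mem_hodgeGroupLieRat_prod_iff` (`(0 0; 0 W) ∈ 𝒜(X) ⟺ W ⊗ 1 ∈ Lie K₂`)
  and mirror, **`coe_lieAlgebraGL_hodgeGroupCProdInr_eq_span`** / `…Inl…` (`Lie K₂ = 𝔤₂(ℚ) ⊗ ℂ` with
  `𝔤₂(ℚ) = {W ∈ M(ℚ) | (0 0; 0 W) ∈ 𝒜(X)}`), **`exists_lieIdeal_rat_lieEquiv_quotient`** (MOONEN–ZARHIN (3.1) OVER `ℚ`: ideals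
  `N₁ ⊆ 𝒜(X₁)`, `N₂ ⊆ 𝒜(X₂)` with these carriers, `N_i ⊗ ℂ = Lie Kᵢ`, `dim_ℚ Nᵢ = dim Kᵢ°`, a `ℚ`-isomorphism
  `𝒜(X₁) ⧸ N₁ ≅ 𝒜(X₂) ⧸ N₂`, and `dim_ℚ 𝒜(X) = dim_ℚ 𝒜(X₁) + dim_ℚ N₂ = dim_ℚ 𝒜(X₂) + dim_ℚ N₁`).
* §4 **SPLITTING OVER `ℚ` ⟺ SPLITTING OF THE GROUPS**: `finrank_hodgeGroupLieRat_prod_eq_add_iff`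
  (`dim_ℚ 𝒜(X) = dim_ℚ 𝒜(X₁) + dim_ℚ 𝒜(X₂) ⟺ Hg(X₁ × X₂)(ℂ) = Hg(X₁)(ℂ) × Hg(X₂)(ℂ)`),
  **`hodgeGroupC_prod_eq_blockDiagProd_iff_forall_fromBlocks_mem_hodgeGroupLieRat`** (`⟺ 𝒜(X₁ × X₂) = 𝒜(X₁) ⊕ 𝒜(X₂)`, i.e.
  `(A 0; 0 B) ∈ 𝒜(X)` for all `A ∈ 𝒜(X₁)`, `B ∈ 𝒜(X₂)`), `hodgeGroupC_prod_eq_blockDiagProd_iff_coe_hodgeGroupLieRat_prod_eq_image`,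
  the one-sided tests `hodgeGroupC_prod_eq_blockDiagProd_iff_forall_fromBlocks_zero_mem` (`⟺ (A 0; 0 0) ∈ 𝒜(X)` for all
  `A ∈ 𝒜(X₁)`) and `hodgeGroupC_prod_eq_blockDiagProd_iff_forall_zero_fromBlocks_mem` (`⟺ (0 0; 0 B) ∈ 𝒜(X)` for all `B ∈ 𝒜(X₂)`),
  `finrank_hodgeGroupLieRat_prod_lt_add_iff`, and the real points `hodgeGroup_prod_eq_of_forall_fromBlocks_mem_hodgeGroupLieRat`.

NOT here (next rows): the centre `𝔷(𝒜(X₁)) = 𝒜(X₁) ∩ End⁰(X₁)` versus a solvable factor (Moonen–Zarhin Lemma (3.6) ∕ Prop.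
(3.8) with RATIONAL endomorphism witnesses); `ℚ`-simple ideals; algebraicity of Lie subalgebras (tori, replicas).
-/

noncomputable section

open Matrix Module Function

namespace Literature.Geometry.Kaehler

namespace ComplexTorus

open Literature.NumberTheory.Automorphic (IsAlgebraicSubgroup IsZConnected identityComponent isZConnected_identityComponent
  lieAlgebraGL lieSubalgebraGL)
open Literature.Algebra.Lie

/-! ### §0 Block and cast plumbing (file-local) -/

section Plumbing

variable {m m' : Type*} {R S : Type*}

/-- `(C ⊗ 1)₁₁ = C₁₁ ⊗ 1`. [folklore] -/
private theorem toBlocks₁₁_map (C : Matrix (m ⊕ m') (m ⊕ m') R) (φ : R → S) : (C.map φ).toBlocks₁₁ = C.toBlocks₁₁.map φ := rfl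

/-- `(C ⊗ 1)₂₂ = C₂₂ ⊗ 1`. [folklore] -/
private theorem toBlocks₂₂_map (C : Matrix (m ⊕ m') (m ⊕ m') R) (φ : R → S) : (C.map φ).toBlocks₂₂ = C.toBlocks₂₂.map φ := rfl

variable [CommRing R]

/-- Commutator of block-diagonal matrices. [folklore] -/
private theorem fromBlocks_diag_commutator [Fintype m] [Fintype m'] (A A' : Matrix m m R) (B B' : Matrix m' m' R) :
    fromBlocks A 0 0 B * fromBlocks A' 0 0 B' - fromBlocks A' 0 0 B' * fromBlocks A 0 0 B =
      fromBlocks (A * A' - A' * A) 0 0 (B * B' - B' * B) := by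
  simp only [fromBlocks_multiply, Matrix.mul_zero, Matrix.zero_mul, add_zero, zero_add, sub_eq_add_neg,
    fromBlocks_neg, fromBlocks_add, neg_zero]

/-- `(A 0; 0 B) = (A 0; 0 0) + (0 0; 0 B)`. [folklore] -/
private theorem fromBlocks_diag_eq_add (A : Matrix m m R) (B : Matrix m' m' R) :
    fromBlocks A 0 0 B = fromBlocks A 0 0 (0 : Matrix m' m' R) + fromBlocks (0 : Matrix m m R) 0 0 B := by
  rw [fromBlocks_add]; simp

end Plumbing

/-! ### §1 `A ∈ 𝒜(X) ⟺ A ⊗ 1 ∈ Lie Hg(X)(ℂ)` -/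

section OneTorus

variable {ι : Type*} [Fintype ι] [DecidableEq ι] {E : Type*} [NormedAddCommGroup E] [NormedSpace ℂ E]
  (Φ : (ι → ℝ) ≃L[ℝ] E)

/-- **`A ∈ 𝒜(X) ⟺ A ⊗ 1 ∈ Lie Hg(X)(ℂ)`** (the algebraic Lie algebra of `Hg(X)(ℂ) ≤ GL(V_ℂ)`): `Lie Hg(X)(ℂ) = 𝒜 ⊗ ℂ` and the
rational points of `𝒜 ⊗ ℂ` are `𝒜`. [cite: GreenGriffithsKerr2012, §II.C, Lemma after (II.C.1) ("`𝒜_ℂ = 𝒜 ⊗ ℂ`")]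
[cite: Springer1998, §11.1.1 (e) ("`V(E) = E ⊗_F V(F)`")] -/
theorem mem_hodgeGroupLieRat_iff_map_ratCast_mem_lieAlgebraGL {A : Matrix ι ι ℚ} :
    A ∈ hodgeGroupLieRat Φ ↔
      A.map ((↑) : ℚ → ℂ) ∈ lieAlgebraGL ((hodgeGroupC Φ).map Matrix.SpecialLinearGroup.toGL) := by
  letI : LieRing (Matrix ι ι ℚ) := LieRing.ofAssociativeRing
  letI : LieAlgebra ℚ (Matrix ι ι ℚ) := LieAlgebra.ofAssociativeAlgebra
  rw [← mem_hodgeGroupLieC_iff_mem_lieAlgebraGL, mem_hodgeGroupLieC_iff_mem_span_hodgeGroupLieRat]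
  exact (map_ratCast_mem_span_image_iff_mem ℂ (hodgeGroupLieRat Φ).toSubmodule).symm

/-- `Lie Hg(X)(ℂ) = 𝒜 ⊗ ℂ` for the algebraic Lie algebra: the carrier of `lieAlgebraGL (Hg(X)(ℂ))` is the complex span of `𝒜 ⊗ 1`.
[cite: GreenGriffithsKerr2012, §II.C, Lemma after (II.C.1) ("`𝒜_ℂ = 𝒜 ⊗ ℂ`")] -/
theorem coe_lieAlgebraGL_hodgeGroupC_eq_span_hodgeGroupLieRat :
    (lieAlgebraGL ((hodgeGroupC Φ).map Matrix.SpecialLinearGroup.toGL) : Set (Matrix ι ι ℂ)) =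
      Submodule.span ℂ ((fun A : Matrix ι ι ℚ ↦ A.map ((↑) : ℚ → ℂ)) '' (hodgeGroupLieRat Φ : Set (Matrix ι ι ℚ))) := by
  rw [← coe_hodgeGroupLieC_eq_coe_lieAlgebraGL, coe_hodgeGroupLieC_eq_span_hodgeGroupLieRat]

/-- `dim_ℚ 𝒜(X) = dim Hg(X)` (the dimension of the connected algebraic group `Hg(X)(ℂ)`). [cite: Springer1998, 4.4.5–4.4.7]
[cite: GreenGriffithsKerr2012, §II.C, Lemma after (II.C.1)] -/
theorem finrank_hodgeGroupLieRat_eq_zdim :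
    finrank ℚ (hodgeGroupLieRat Φ) = (isZConnected_map_toGL_hodgeGroupC Φ).zdim := by
  rw [finrank_hodgeGroupLieRat_eq_finrank_hodgeGroupComplexLie, finrank_hodgeGroupComplexLie_eq_zdim]

end OneTorus

/-! ### §2 The block projections `𝒜(X₁ × X₂) → 𝒜(Xᵢ)` are onto over `ℚ`: the Goursat position over `ℚ` -/

section Position

variable {ι₁ ι₂ : Type*} [Fintype ι₁] [Fintype ι₂] [DecidableEq ι₁] [DecidableEq ι₂]
  {E₁ E₂ : Type*} [NormedAddCommGroup E₁] [NormedSpace ℂ E₁] [NormedAddCommGroup E₂] [NormedSpace ℂ E₂]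
  (Φ₁ : (ι₁ → ℝ) ≃L[ℝ] E₁) (Φ₂ : (ι₂ → ℝ) ≃L[ℝ] E₂)

/-- **THE FIRST BLOCK PROJECTION `𝒜(X₁ × X₂) → 𝒜(X₁)` IS ONTO, OVER `ℚ`.**  Every `A ∈ 𝒜(X₁)` is the block `C₁₁` of some
`C ∈ 𝒜(X₁ × X₂)`.  Proof: the image `W ⊆ 𝒜(X₁)` is a `ℚ`-subspace; the complex projection `Lie Hg(X₁ × X₂)(ℂ) → Lie Hg(X₁)(ℂ)`
is onto (g40-#7) and `Lie Hg(·)(ℂ) = 𝒜(·) ⊗ ℂ`, so `A ⊗ 1 ∈ W ⊗ ℂ`, whence `A ∈ W` (rational points). «`Im f` is defined over `F`.»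
[cite: MoonenZarhin1999LowDim, §3 (3.1) ("The two projections `prᵢ : Hg(X) → Hg(Xᵢ)` are surjective")]
[cite: Springer1998, §11.1.2 (a) ("`Im f` is defined over `F`")] [cite: GreenGriffithsKerr2012, §II.C, Lemma after (II.C.1)] -/
theorem exists_mem_hodgeGroupLieRat_prod_toBlocks₁₁_eq {A : Matrix ι₁ ι₁ ℚ} (hA : A ∈ hodgeGroupLieRat Φ₁) :
    ∃ C ∈ hodgeGroupLieRat (prodPeriod Φ₁ Φ₂), C.toBlocks₁₁ = A := by
  classical
  letI : LieRing (Matrix (ι₁ ⊕ ι₂) (ι₁ ⊕ ι₂) ℚ) := LieRing.ofAssociativeRing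
  letI : LieAlgebra ℚ (Matrix (ι₁ ⊕ ι₂) (ι₁ ⊕ ι₂) ℚ) := LieAlgebra.ofAssociativeAlgebra
  -- the rational image `W` of the first block projection
  let T : Matrix (ι₁ ⊕ ι₂) (ι₁ ⊕ ι₂) ℚ →ₗ[ℚ] Matrix ι₁ ι₁ ℚ :=
    { toFun := fun C ↦ C.toBlocks₁₁, map_add' := fun _ _ ↦ rfl, map_smul' := fun _ _ ↦ rfl }
  let W : Submodule ℚ (Matrix ι₁ ι₁ ℚ) := (hodgeGroupLieRat (prodPeriod Φ₁ Φ₂)).toSubmodule.map T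
  suffices h : A ∈ W by
    obtain ⟨C, hC, hCA⟩ := Submodule.mem_map.1 h
    exact ⟨C, hC, hCA⟩
  -- the complex projection and a lift of `A ⊗ 1`
  let Tc : Matrix (ι₁ ⊕ ι₂) (ι₁ ⊕ ι₂) ℂ →ₗ[ℂ] Matrix ι₁ ι₁ ℂ :=
    { toFun := fun Z ↦ Z.toBlocks₁₁, map_add' := fun _ _ ↦ rfl, map_smul' := fun _ _ ↦ rfl }
  have hA' : A.map ((↑) : ℚ → ℂ) ∈ lieAlgebraGL ((hodgeGroupC Φ₁).map Matrix.SpecialLinearGroup.toGL) :=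
    (mem_hodgeGroupLieRat_iff_map_ratCast_mem_lieAlgebraGL Φ₁).1 hA
  obtain ⟨f, g, hf, -, hfs, -, -⟩ := exists_lieHom_toBlocks Φ₁ Φ₂
  obtain ⟨Z, hZ⟩ := hfs ⟨A.map ((↑) : ℚ → ℂ), hA'⟩
  have hZA : (Z : Matrix (ι₁ ⊕ ι₂) (ι₁ ⊕ ι₂) ℂ).toBlocks₁₁ = A.map ((↑) : ℚ → ℂ) := by
    rw [← hf Z, hZ]
  -- `Z ∈ 𝒜(X) ⊗ ℂ`, so `Z₁₁ ∈ W ⊗ ℂ`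
  have hZmem : (Z : Matrix (ι₁ ⊕ ι₂) (ι₁ ⊕ ι₂) ℂ) ∈ Submodule.span ℂ ((fun C : Matrix (ι₁ ⊕ ι₂) (ι₁ ⊕ ι₂) ℚ ↦
      C.map ((↑) : ℚ → ℂ)) '' (hodgeGroupLieRat (prodPeriod Φ₁ Φ₂) : Set (Matrix (ι₁ ⊕ ι₂) (ι₁ ⊕ ι₂) ℚ))) := by
    rw [← SetLike.mem_coe, ← coe_lieAlgebraGL_hodgeGroupC_eq_span_hodgeGroupLieRat]
    exact Z.2
  have himage : Tc '' ((fun C : Matrix (ι₁ ⊕ ι₂) (ι₁ ⊕ ι₂) ℚ ↦ C.map ((↑) : ℚ → ℂ)) ''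
      (hodgeGroupLieRat (prodPeriod Φ₁ Φ₂) : Set (Matrix (ι₁ ⊕ ι₂) (ι₁ ⊕ ι₂) ℚ))) ⊆
        (fun B : Matrix ι₁ ι₁ ℚ ↦ B.map ((↑) : ℚ → ℂ)) '' (W : Set (Matrix ι₁ ι₁ ℚ)) := by
    rintro _ ⟨_, ⟨C, hC, rfl⟩, rfl⟩
    exact ⟨C.toBlocks₁₁, Submodule.mem_map_of_mem (f := T) hC, (toBlocks₁₁_map C _).symm⟩
  have hmem : A.map ((↑) : ℚ → ℂ) ∈ Submodule.span ℂ ((fun B : Matrix ι₁ ι₁ ℚ ↦ B.map ((↑) : ℚ → ℂ)) ''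
      (W : Set (Matrix ι₁ ι₁ ℚ))) := by
    rw [← hZA]
    have h := Submodule.mem_map_of_mem (f := Tc) hZmem
    rw [Submodule.map_span] at h
    exact Submodule.span_mono himage h
  exact (map_ratCast_mem_span_image_iff_mem ℂ W).1 hmem

/-- **THE SECOND BLOCK PROJECTION `𝒜(X₁ × X₂) → 𝒜(X₂)` IS ONTO, OVER `ℚ`.** [cite: MoonenZarhin1999LowDim, §3 (3.1)]
[cite: Springer1998, §11.1.2 (a)] [cite: GreenGriffithsKerr2012, §II.C, Lemma after (II.C.1)] -/
theorem exists_mem_hodgeGroupLieRat_prod_toBlocks₂₂_eq {B : Matrix ι₂ ι₂ ℚ} (hB : B ∈ hodgeGroupLieRat Φ₂) :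
    ∃ C ∈ hodgeGroupLieRat (prodPeriod Φ₁ Φ₂), C.toBlocks₂₂ = B := by
  classical
  letI : LieRing (Matrix (ι₁ ⊕ ι₂) (ι₁ ⊕ ι₂) ℚ) := LieRing.ofAssociativeRing
  letI : LieAlgebra ℚ (Matrix (ι₁ ⊕ ι₂) (ι₁ ⊕ ι₂) ℚ) := LieAlgebra.ofAssociativeAlgebra
  let T : Matrix (ι₁ ⊕ ι₂) (ι₁ ⊕ ι₂) ℚ →ₗ[ℚ] Matrix ι₂ ι₂ ℚ :=
    { toFun := fun C ↦ C.toBlocks₂₂, map_add' := fun _ _ ↦ rfl, map_smul' := fun _ _ ↦ rfl }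
  let W : Submodule ℚ (Matrix ι₂ ι₂ ℚ) := (hodgeGroupLieRat (prodPeriod Φ₁ Φ₂)).toSubmodule.map T
  suffices h : B ∈ W by
    obtain ⟨C, hC, hCB⟩ := Submodule.mem_map.1 h
    exact ⟨C, hC, hCB⟩
  let Tc : Matrix (ι₁ ⊕ ι₂) (ι₁ ⊕ ι₂) ℂ →ₗ[ℂ] Matrix ι₂ ι₂ ℂ :=
    { toFun := fun Z ↦ Z.toBlocks₂₂, map_add' := fun _ _ ↦ rfl, map_smul' := fun _ _ ↦ rfl }
  have hB' : B.map ((↑) : ℚ → ℂ) ∈ lieAlgebraGL ((hodgeGroupC Φ₂).map Matrix.SpecialLinearGroup.toGL) :=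
    (mem_hodgeGroupLieRat_iff_map_ratCast_mem_lieAlgebraGL Φ₂).1 hB
  obtain ⟨f, g, -, hg, -, hgs, -⟩ := exists_lieHom_toBlocks Φ₁ Φ₂
  obtain ⟨Z, hZ⟩ := hgs ⟨B.map ((↑) : ℚ → ℂ), hB'⟩
  have hZB : (Z : Matrix (ι₁ ⊕ ι₂) (ι₁ ⊕ ι₂) ℂ).toBlocks₂₂ = B.map ((↑) : ℚ → ℂ) := by
    rw [← hg Z, hZ]
  have hZmem : (Z : Matrix (ι₁ ⊕ ι₂) (ι₁ ⊕ ι₂) ℂ) ∈ Submodule.span ℂ ((fun C : Matrix (ι₁ ⊕ ι₂) (ι₁ ⊕ ι₂) ℚ ↦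
      C.map ((↑) : ℚ → ℂ)) '' (hodgeGroupLieRat (prodPeriod Φ₁ Φ₂) : Set (Matrix (ι₁ ⊕ ι₂) (ι₁ ⊕ ι₂) ℚ))) := by
    rw [← SetLike.mem_coe, ← coe_lieAlgebraGL_hodgeGroupC_eq_span_hodgeGroupLieRat]
    exact Z.2
  have himage : Tc '' ((fun C : Matrix (ι₁ ⊕ ι₂) (ι₁ ⊕ ι₂) ℚ ↦ C.map ((↑) : ℚ → ℂ)) ''
      (hodgeGroupLieRat (prodPeriod Φ₁ Φ₂) : Set (Matrix (ι₁ ⊕ ι₂) (ι₁ ⊕ ι₂) ℚ))) ⊆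
        (fun B : Matrix ι₂ ι₂ ℚ ↦ B.map ((↑) : ℚ → ℂ)) '' (W : Set (Matrix ι₂ ι₂ ℚ)) := by
    rintro _ ⟨_, ⟨C, hC, rfl⟩, rfl⟩
    exact ⟨C.toBlocks₂₂, Submodule.mem_map_of_mem (f := T) hC, (toBlocks₂₂_map C _).symm⟩
  have hmem : B.map ((↑) : ℚ → ℂ) ∈ Submodule.span ℂ ((fun B : Matrix ι₂ ι₂ ℚ ↦ B.map ((↑) : ℚ → ℂ)) ''
      (W : Set (Matrix ι₂ ι₂ ℚ))) := by
    rw [← hZB]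
    have h := Submodule.mem_map_of_mem (f := Tc) hZmem
    rw [Submodule.map_span] at h
    exact Submodule.span_mono himage h
  exact (map_ratCast_mem_span_image_iff_mem ℂ W).1 hmem

/-- `𝒜(X₁)` is exactly the set of first blocks of `𝒜(X₁ × X₂)`. [cite: MoonenZarhin1999LowDim, §3 (3.1)] -/
theorem image_toBlocks₁₁_hodgeGroupLieRat_prod :
    (fun C : Matrix (ι₁ ⊕ ι₂) (ι₁ ⊕ ι₂) ℚ ↦ C.toBlocks₁₁) '' (hodgeGroupLieRat (prodPeriod Φ₁ Φ₂) : Set _) =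
      (hodgeGroupLieRat Φ₁ : Set (Matrix ι₁ ι₁ ℚ)) := by
  refine Set.Subset.antisymm ?_ fun A hA ↦ ?_
  · rintro _ ⟨C, hC, rfl⟩
    exact toBlocks₁₁_mem_hodgeGroupLieRat Φ₁ Φ₂ hC
  · obtain ⟨C, hC, hCA⟩ := exists_mem_hodgeGroupLieRat_prod_toBlocks₁₁_eq Φ₁ Φ₂ hA
    exact ⟨C, hC, hCA⟩

/-- `𝒜(X₂)` is exactly the set of second blocks of `𝒜(X₁ × X₂)`. [cite: MoonenZarhin1999LowDim, §3 (3.1)] -/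
theorem image_toBlocks₂₂_hodgeGroupLieRat_prod :
    (fun C : Matrix (ι₁ ⊕ ι₂) (ι₁ ⊕ ι₂) ℚ ↦ C.toBlocks₂₂) '' (hodgeGroupLieRat (prodPeriod Φ₁ Φ₂) : Set _) =
      (hodgeGroupLieRat Φ₂ : Set (Matrix ι₂ ι₂ ℚ)) := by
  refine Set.Subset.antisymm ?_ fun B hB ↦ ?_
  · rintro _ ⟨C, hC, rfl⟩
    exact toBlocks₂₂_mem_hodgeGroupLieRat Φ₁ Φ₂ hC
  · obtain ⟨C, hC, hCB⟩ := exists_mem_hodgeGroupLieRat_prod_toBlocks₂₂_eq Φ₁ Φ₂ hB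
    exact ⟨C, hC, hCB⟩

/-- **THE GOURSAT POSITION OF `𝒜(X₁ × X₂)` OVER `ℚ`.**  There are homomorphisms of `ℚ`-Lie algebras `r₁ : 𝒜(X₁ × X₂) → 𝒜(X₁)`,
`r₂ : 𝒜(X₁ × X₂) → 𝒜(X₂)`, `C ↦ C₁₁`, `C ↦ C₂₂`, both SURJECTIVE, with `ker r₁ ⊓ ker r₂ = 0` — Moonen–Zarhin's «`Hg(X)` is an
algebraic subgroup of `Hg(X₁) × Hg(X₂)`; the two projections are surjective» at the rational Lie algebra.
[cite: MoonenZarhin1999LowDim, §3 (3.1)] [cite: Gordon1997, §2.16 Proposition] [cite: GreenGriffithsKerr2012, §III.B (i)] -/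
theorem exists_lieHom_toBlocks_rat :
    ∃ (f : hodgeGroupLieRat (prodPeriod Φ₁ Φ₂) →ₗ⁅ℚ⁆ hodgeGroupLieRat Φ₁)
      (g : hodgeGroupLieRat (prodPeriod Φ₁ Φ₂) →ₗ⁅ℚ⁆ hodgeGroupLieRat Φ₂),
      (∀ C, ((f C : hodgeGroupLieRat Φ₁) : Matrix ι₁ ι₁ ℚ) = (C : Matrix (ι₁ ⊕ ι₂) (ι₁ ⊕ ι₂) ℚ).toBlocks₁₁) ∧
      (∀ C, ((g C : hodgeGroupLieRat Φ₂) : Matrix ι₂ ι₂ ℚ) = (C : Matrix (ι₁ ⊕ ι₂) (ι₁ ⊕ ι₂) ℚ).toBlocks₂₂) ∧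
      Surjective f ∧ Surjective g ∧ f.ker ⊓ g.ker = ⊥ := by
  letI : LieRing (Matrix (ι₁ ⊕ ι₂) (ι₁ ⊕ ι₂) ℚ) := LieRing.ofAssociativeRing
  letI : LieAlgebra ℚ (Matrix (ι₁ ⊕ ι₂) (ι₁ ⊕ ι₂) ℚ) := LieAlgebra.ofAssociativeAlgebra
  letI : LieRing (Matrix ι₁ ι₁ ℚ) := LieRing.ofAssociativeRing
  letI : LieAlgebra ℚ (Matrix ι₁ ι₁ ℚ) := LieAlgebra.ofAssociativeAlgebra
  letI : LieRing (Matrix ι₂ ι₂ ℚ) := LieRing.ofAssociativeRing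
  letI : LieAlgebra ℚ (Matrix ι₂ ι₂ ℚ) := LieAlgebra.ofAssociativeAlgebra
  have hblk : ∀ C : hodgeGroupLieRat (prodPeriod Φ₁ Φ₂), (C : Matrix (ι₁ ⊕ ι₂) (ι₁ ⊕ ι₂) ℚ) =
      fromBlocks (C : Matrix (ι₁ ⊕ ι₂) (ι₁ ⊕ ι₂) ℚ).toBlocks₁₁ 0 0 (C : Matrix (ι₁ ⊕ ι₂) (ι₁ ⊕ ι₂) ℚ).toBlocks₂₂ :=
    fun C ↦ eq_fromBlocks_of_mem_hodgeGroupLieRat_prod Φ₁ Φ₂ C.2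
  have hbr : ∀ C D : hodgeGroupLieRat (prodPeriod Φ₁ Φ₂), ((⁅C, D⁆ : hodgeGroupLieRat (prodPeriod Φ₁ Φ₂)) :
      Matrix (ι₁ ⊕ ι₂) (ι₁ ⊕ ι₂) ℚ) =
        fromBlocks ((C : Matrix (ι₁ ⊕ ι₂) (ι₁ ⊕ ι₂) ℚ).toBlocks₁₁ * (D : Matrix (ι₁ ⊕ ι₂) (ι₁ ⊕ ι₂) ℚ).toBlocks₁₁ -
            (D : Matrix (ι₁ ⊕ ι₂) (ι₁ ⊕ ι₂) ℚ).toBlocks₁₁ * (C : Matrix (ι₁ ⊕ ι₂) (ι₁ ⊕ ι₂) ℚ).toBlocks₁₁) 0 0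
          ((C : Matrix (ι₁ ⊕ ι₂) (ι₁ ⊕ ι₂) ℚ).toBlocks₂₂ * (D : Matrix (ι₁ ⊕ ι₂) (ι₁ ⊕ ι₂) ℚ).toBlocks₂₂ -
            (D : Matrix (ι₁ ⊕ ι₂) (ι₁ ⊕ ι₂) ℚ).toBlocks₂₂ * (C : Matrix (ι₁ ⊕ ι₂) (ι₁ ⊕ ι₂) ℚ).toBlocks₂₂) := by
    intro C D
    rw [LieSubalgebra.coe_bracket, Ring.lie_def]
    conv_lhs => rw [hblk C, hblk D]
    exact fromBlocks_diag_commutator _ _ _ _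
  let f : hodgeGroupLieRat (prodPeriod Φ₁ Φ₂) →ₗ⁅ℚ⁆ hodgeGroupLieRat Φ₁ :=
    { toFun := fun C ↦ ⟨(C : Matrix (ι₁ ⊕ ι₂) (ι₁ ⊕ ι₂) ℚ).toBlocks₁₁, toBlocks₁₁_mem_hodgeGroupLieRat Φ₁ Φ₂ C.2⟩
      map_add' := fun _ _ ↦ rfl
      map_smul' := fun _ _ ↦ rfl
      map_lie' := fun {C D} ↦ Subtype.ext (by
        change ((⁅C, D⁆ : hodgeGroupLieRat (prodPeriod Φ₁ Φ₂)) : Matrix (ι₁ ⊕ ι₂) (ι₁ ⊕ ι₂) ℚ).toBlocks₁₁ =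
          (C : Matrix (ι₁ ⊕ ι₂) (ι₁ ⊕ ι₂) ℚ).toBlocks₁₁ * (D : Matrix (ι₁ ⊕ ι₂) (ι₁ ⊕ ι₂) ℚ).toBlocks₁₁ - (D : Matrix (ι₁ ⊕ ι₂) (ι₁ ⊕ ι₂) ℚ).toBlocks₁₁ * (C : Matrix (ι₁ ⊕ ι₂) (ι₁ ⊕ ι₂) ℚ).toBlocks₁₁
        rw [hbr, toBlocks_fromBlocks₁₁]) }
  let g : hodgeGroupLieRat (prodPeriod Φ₁ Φ₂) →ₗ⁅ℚ⁆ hodgeGroupLieRat Φ₂ :=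
    { toFun := fun C ↦ ⟨(C : Matrix (ι₁ ⊕ ι₂) (ι₁ ⊕ ι₂) ℚ).toBlocks₂₂, toBlocks₂₂_mem_hodgeGroupLieRat Φ₁ Φ₂ C.2⟩
      map_add' := fun _ _ ↦ rfl
      map_smul' := fun _ _ ↦ rfl
      map_lie' := fun {C D} ↦ Subtype.ext (by
        change ((⁅C, D⁆ : hodgeGroupLieRat (prodPeriod Φ₁ Φ₂)) : Matrix (ι₁ ⊕ ι₂) (ι₁ ⊕ ι₂) ℚ).toBlocks₂₂ =
          (C : Matrix (ι₁ ⊕ ι₂) (ι₁ ⊕ ι₂) ℚ).toBlocks₂₂ * (D : Matrix (ι₁ ⊕ ι₂) (ι₁ ⊕ ι₂) ℚ).toBlocks₂₂ - (D : Matrix (ι₁ ⊕ ι₂) (ι₁ ⊕ ι₂) ℚ).toBlocks₂₂ * (C : Matrix (ι₁ ⊕ ι₂) (ι₁ ⊕ ι₂) ℚ).toBlocks₂₂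
        rw [hbr, toBlocks_fromBlocks₂₂]) }
  refine ⟨f, g, fun _ ↦ rfl, fun _ ↦ rfl, ?_, ?_, ?_⟩
  · rintro ⟨A, hA⟩
    obtain ⟨C, hC, hCA⟩ := exists_mem_hodgeGroupLieRat_prod_toBlocks₁₁_eq Φ₁ Φ₂ hA
    exact ⟨⟨C, hC⟩, Subtype.ext hCA⟩
  · rintro ⟨B, hB⟩
    obtain ⟨C, hC, hCB⟩ := exists_mem_hodgeGroupLieRat_prod_toBlocks₂₂_eq Φ₁ Φ₂ hB
    exact ⟨⟨C, hC⟩, Subtype.ext hCB⟩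
  · rw [eq_bot_iff]
    intro C hC
    rw [LieSubmodule.mem_inf, LieHom.mem_ker, LieHom.mem_ker] at hC
    have h₁ : (C : Matrix (ι₁ ⊕ ι₂) (ι₁ ⊕ ι₂) ℚ).toBlocks₁₁ = 0 := congrArg Subtype.val hC.1
    have h₂ : (C : Matrix (ι₁ ⊕ ι₂) (ι₁ ⊕ ι₂) ℚ).toBlocks₂₂ = 0 := congrArg Subtype.val hC.2
    rw [LieSubmodule.mem_bot, ← Subtype.coe_inj, ZeroMemClass.coe_zero, hblk C, h₁, h₂, fromBlocks_zero]

end Position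

/-! ### §3 The Goursat ideals `𝔤₁ = Lie K₁`, `𝔤₂ = Lie K₂` are defined over `ℚ`; Moonen–Zarhin (3.1) over `ℚ` -/

section Kernels

variable {ι₁ ι₂ : Type*} [Fintype ι₁] [Fintype ι₂] [DecidableEq ι₁] [DecidableEq ι₂]
  {E₁ E₂ : Type*} [NormedAddCommGroup E₁] [NormedSpace ℂ E₁] [NormedAddCommGroup E₂] [NormedSpace ℂ E₂]
  (Φ₁ : (ι₁ → ℝ) ≃L[ℝ] E₁) (Φ₂ : (ι₂ → ℝ) ≃L[ℝ] E₂)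

omit [Fintype ι₁] [Fintype ι₂] [DecidableEq ι₁] [DecidableEq ι₂] in
/-- `0 ⊗ 1 = 0` (any shape). [folklore] -/
private theorem map_ratCast_zero {m n : Type*} : (0 : Matrix m n ℚ).map ((↑) : ℚ → ℂ) = 0 :=
  Matrix.map_zero _ Rat.cast_zero

/-- **`(0 0; 0 W) ∈ 𝒜(X₁ × X₂) ⟺ W ⊗ 1 ∈ Lie K₂`** (`K₂ = {t | (1 0; 0 t) ∈ Hg(X₁ × X₂)(ℂ)}`): the rational points of the kernel
of the first complex block projection. [cite: MoonenZarhin1999LowDim, §3 (3.1)] [cite: Springer1998, §11.1.2 (a) ("`Ker f` is defined over `F`")] -/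
theorem fromBlocks_zero_mem_hodgeGroupLieRat_prod_iff {W : Matrix ι₂ ι₂ ℚ} :
    fromBlocks (0 : Matrix ι₁ ι₁ ℚ) 0 0 W ∈ hodgeGroupLieRat (prodPeriod Φ₁ Φ₂) ↔
      W.map ((↑) : ℚ → ℂ) ∈ lieAlgebraGL ((hodgeGroupCProdInr Φ₁ Φ₂).map Matrix.SpecialLinearGroup.toGL) := by
  rw [mem_hodgeGroupLieRat_iff_map_ratCast_mem_lieAlgebraGL, fromBlocks_map, map_ratCast_zero, map_ratCast_zero,
    map_ratCast_zero, fromBlocks_zero_mem_lieAlgebraGL_hodgeGroupC_prod_iff]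

/-- **`(W 0; 0 0) ∈ 𝒜(X₁ × X₂) ⟺ W ⊗ 1 ∈ Lie K₁`** (`K₁ = {s | (s 0; 0 1) ∈ Hg(X₁ × X₂)(ℂ)}`).
[cite: MoonenZarhin1999LowDim, §3 (3.1)] [cite: Springer1998, §11.1.2 (a)] -/
theorem fromBlocks_mem_hodgeGroupLieRat_prod_zero_iff {W : Matrix ι₁ ι₁ ℚ} :
    fromBlocks W 0 0 (0 : Matrix ι₂ ι₂ ℚ) ∈ hodgeGroupLieRat (prodPeriod Φ₁ Φ₂) ↔
      W.map ((↑) : ℚ → ℂ) ∈ lieAlgebraGL ((hodgeGroupCProdInl Φ₁ Φ₂).map Matrix.SpecialLinearGroup.toGL) := by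
  rw [mem_hodgeGroupLieRat_iff_map_ratCast_mem_lieAlgebraGL, fromBlocks_map, map_ratCast_zero, map_ratCast_zero,
    map_ratCast_zero, fromBlocks_mem_lieAlgebraGL_hodgeGroupC_prod_zero_iff]

/-- **`Lie K₂` IS DEFINED OVER `ℚ`: `Lie K₂ = 𝔤₂(ℚ) ⊗_ℚ ℂ`** with `𝔤₂(ℚ) = {W ∈ M(ℚ) | (0 0; 0 W) ∈ 𝒜(X₁ × X₂)}` — every element of
`Lie K₂` is a complex combination of casts of RATIONAL elements of the kernel (Bourbaki: write `W = Σ λ_k (w_k ⊗ 1)` with the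
`λ_k` independent over `ℚ`; then `(0 0; 0 W) = Σ λ_k ((0 0; 0 w_k) ⊗ 1) ∈ 𝒜(X) ⊗ ℂ` forces `(0 0; 0 w_k) ∈ 𝒜(X)`).  Moonen–Zarhin:
«`𝔤₁` and `𝔤₃` are algebraic Lie subalgebras of `𝔥𝔤(X)`» — in particular defined over `ℚ`. [cite: MoonenZarhin1999LowDim, §3 (3.1) and Lemma (3.6), proof]
[cite: Bourbaki1989LieGroups13, Ch. I §3 no. 8] [cite: Springer1998, §11.1.2 (a) ("`Ker f` is defined over `F`")] -/
theorem coe_lieAlgebraGL_hodgeGroupCProdInr_eq_span :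
    (lieAlgebraGL ((hodgeGroupCProdInr Φ₁ Φ₂).map Matrix.SpecialLinearGroup.toGL) : Set (Matrix ι₂ ι₂ ℂ)) =
      Submodule.span ℂ ((fun W : Matrix ι₂ ι₂ ℚ ↦ W.map ((↑) : ℚ → ℂ)) ''
        {W : Matrix ι₂ ι₂ ℚ | fromBlocks (0 : Matrix ι₁ ι₁ ℚ) 0 0 W ∈ hodgeGroupLieRat (prodPeriod Φ₁ Φ₂)}) := by
  classical
  letI : LieRing (Matrix (ι₁ ⊕ ι₂) (ι₁ ⊕ ι₂) ℚ) := LieRing.ofAssociativeRing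
  letI : LieAlgebra ℚ (Matrix (ι₁ ⊕ ι₂) (ι₁ ⊕ ι₂) ℚ) := LieAlgebra.ofAssociativeAlgebra
  refine Set.Subset.antisymm (fun W hW ↦ ?_) (SetLike.coe_subset_coe.2 (Submodule.span_le.2 ?_))
  · obtain ⟨d, c, w, hc, rfl⟩ := exists_sum_smul_map_ratCast_eq ℂ W
    -- the corner embedding `W ↦ (0 0; 0 W)` over `ℂ`
    let L : Matrix ι₂ ι₂ ℂ →ₗ[ℂ] Matrix (ι₁ ⊕ ι₂) (ι₁ ⊕ ι₂) ℂ :=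
      { toFun := fun W ↦ fromBlocks 0 0 0 W
        map_add' := fun W W' ↦ by rw [fromBlocks_add, add_zero, add_zero, add_zero]
        map_smul' := fun a W ↦ by rw [RingHom.id_apply, fromBlocks_smul, smul_zero, smul_zero, smul_zero] }
    have hL : ∀ k, (fromBlocks (0 : Matrix ι₁ ι₁ ℚ) 0 0 (w k)).map ((↑) : ℚ → ℂ) = L ((w k).map ((↑) : ℚ → ℂ)) := by
      intro k
      rw [fromBlocks_map, map_ratCast_zero, map_ratCast_zero, map_ratCast_zero]
      rfl
    have hsum : (∑ k, c k • (fromBlocks (0 : Matrix ι₁ ι₁ ℚ) 0 0 (w k)).map ((↑) : ℚ → ℂ)) =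
        fromBlocks 0 0 0 (∑ k, c k • (w k).map ((↑) : ℚ → ℂ)) := by
      simp_rw [hL, ← map_smul, ← map_sum]
      rfl
    have hmem : ∑ k, c k • (fromBlocks (0 : Matrix ι₁ ι₁ ℚ) 0 0 (w k)).map ((↑) : ℚ → ℂ) ∈
        Submodule.span ℂ ((fun C : Matrix (ι₁ ⊕ ι₂) (ι₁ ⊕ ι₂) ℚ ↦ C.map ((↑) : ℚ → ℂ)) ''
          ((hodgeGroupLieRat (prodPeriod Φ₁ Φ₂)).toSubmodule : Set (Matrix (ι₁ ⊕ ι₂) (ι₁ ⊕ ι₂) ℚ))) := by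
      rw [hsum, ← SetLike.mem_coe, LieSubalgebra.coe_toSubmodule, ← coe_lieAlgebraGL_hodgeGroupC_eq_span_hodgeGroupLieRat,
        SetLike.mem_coe]
      exact (fromBlocks_zero_mem_lieAlgebraGL_hodgeGroupC_prod_iff Φ₁ Φ₂).2 hW
    have hk := forall_mem_of_sum_smul_map_ratCast_mem_span ℂ hc (hodgeGroupLieRat (prodPeriod Φ₁ Φ₂)).toSubmodule hmem
    exact Submodule.sum_mem _ fun k _ ↦ Submodule.smul_mem _ _ (Submodule.subset_span ⟨w k, hk k, rfl⟩)
  · rintro _ ⟨W, hW, rfl⟩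
    exact (fromBlocks_zero_mem_hodgeGroupLieRat_prod_iff Φ₁ Φ₂).1 hW

/-- **`Lie K₁` IS DEFINED OVER `ℚ`: `Lie K₁ = 𝔤₁(ℚ) ⊗_ℚ ℂ`**, `𝔤₁(ℚ) = {W ∈ M(ℚ) | (W 0; 0 0) ∈ 𝒜(X₁ × X₂)}`.
[cite: MoonenZarhin1999LowDim, §3 (3.1) and Lemma (3.6), proof ("`𝔤₁` and `𝔤₃` are algebraic Lie subalgebras")]
[cite: Bourbaki1989LieGroups13, Ch. I §3 no. 8] [cite: Springer1998, §11.1.2 (a)] -/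
theorem coe_lieAlgebraGL_hodgeGroupCProdInl_eq_span :
    (lieAlgebraGL ((hodgeGroupCProdInl Φ₁ Φ₂).map Matrix.SpecialLinearGroup.toGL) : Set (Matrix ι₁ ι₁ ℂ)) =
      Submodule.span ℂ ((fun W : Matrix ι₁ ι₁ ℚ ↦ W.map ((↑) : ℚ → ℂ)) ''
        {W : Matrix ι₁ ι₁ ℚ | fromBlocks W 0 0 (0 : Matrix ι₂ ι₂ ℚ) ∈ hodgeGroupLieRat (prodPeriod Φ₁ Φ₂)}) := by
  classical
  letI : LieRing (Matrix (ι₁ ⊕ ι₂) (ι₁ ⊕ ι₂) ℚ) := LieRing.ofAssociativeRing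
  letI : LieAlgebra ℚ (Matrix (ι₁ ⊕ ι₂) (ι₁ ⊕ ι₂) ℚ) := LieAlgebra.ofAssociativeAlgebra
  refine Set.Subset.antisymm (fun W hW ↦ ?_) (SetLike.coe_subset_coe.2 (Submodule.span_le.2 ?_))
  · obtain ⟨d, c, w, hc, rfl⟩ := exists_sum_smul_map_ratCast_eq ℂ W
    let L : Matrix ι₁ ι₁ ℂ →ₗ[ℂ] Matrix (ι₁ ⊕ ι₂) (ι₁ ⊕ ι₂) ℂ :=
      { toFun := fun W ↦ fromBlocks W 0 0 0
        map_add' := fun W W' ↦ by rw [fromBlocks_add, add_zero, add_zero, add_zero]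
        map_smul' := fun a W ↦ by rw [RingHom.id_apply, fromBlocks_smul, smul_zero, smul_zero, smul_zero] }
    have hL : ∀ k, (fromBlocks (w k) 0 0 (0 : Matrix ι₂ ι₂ ℚ)).map ((↑) : ℚ → ℂ) = L ((w k).map ((↑) : ℚ → ℂ)) := by
      intro k
      rw [fromBlocks_map, map_ratCast_zero, map_ratCast_zero, map_ratCast_zero]
      rfl
    have hsum : (∑ k, c k • (fromBlocks (w k) 0 0 (0 : Matrix ι₂ ι₂ ℚ)).map ((↑) : ℚ → ℂ)) =
        fromBlocks (∑ k, c k • (w k).map ((↑) : ℚ → ℂ)) 0 0 0 := by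
      simp_rw [hL, ← map_smul, ← map_sum]
      rfl
    have hmem : ∑ k, c k • (fromBlocks (w k) 0 0 (0 : Matrix ι₂ ι₂ ℚ)).map ((↑) : ℚ → ℂ) ∈
        Submodule.span ℂ ((fun C : Matrix (ι₁ ⊕ ι₂) (ι₁ ⊕ ι₂) ℚ ↦ C.map ((↑) : ℚ → ℂ)) ''
          ((hodgeGroupLieRat (prodPeriod Φ₁ Φ₂)).toSubmodule : Set (Matrix (ι₁ ⊕ ι₂) (ι₁ ⊕ ι₂) ℚ))) := by
      rw [hsum, ← SetLike.mem_coe, LieSubalgebra.coe_toSubmodule, ← coe_lieAlgebraGL_hodgeGroupC_eq_span_hodgeGroupLieRat,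
        SetLike.mem_coe]
      exact (fromBlocks_mem_lieAlgebraGL_hodgeGroupC_prod_zero_iff Φ₁ Φ₂).2 hW
    have hk := forall_mem_of_sum_smul_map_ratCast_mem_span ℂ hc (hodgeGroupLieRat (prodPeriod Φ₁ Φ₂)).toSubmodule hmem
    exact Submodule.sum_mem _ fun k _ ↦ Submodule.smul_mem _ _ (Submodule.subset_span ⟨w k, hk k, rfl⟩)
  · rintro _ ⟨W, hW, rfl⟩
    exact (fromBlocks_mem_hodgeGroupLieRat_prod_zero_iff Φ₁ Φ₂).1 hW

variable {Φ₁ Φ₂} in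
/-- The Goursat ideal `𝔫₁ = r₁(ker r₂) ⊆ 𝒜(X₁)` has carrier `{A | (A 0; 0 0) ∈ 𝒜(X₁ × X₂)}`. [cite: Gordon1997, §2.16 Proposition]
[cite: MoonenZarhin1999LowDim, §3 (3.1)] -/
private theorem mem_map_ker_iff_fromBlocks_zero_mem
    {f : hodgeGroupLieRat (prodPeriod Φ₁ Φ₂) →ₗ⁅ℚ⁆ hodgeGroupLieRat Φ₁}
    {g : hodgeGroupLieRat (prodPeriod Φ₁ Φ₂) →ₗ⁅ℚ⁆ hodgeGroupLieRat Φ₂}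
    (hf : ∀ C, ((f C : hodgeGroupLieRat Φ₁) : Matrix ι₁ ι₁ ℚ) = (C : Matrix (ι₁ ⊕ ι₂) (ι₁ ⊕ ι₂) ℚ).toBlocks₁₁)
    (hg : ∀ C, ((g C : hodgeGroupLieRat Φ₂) : Matrix ι₂ ι₂ ℚ) = (C : Matrix (ι₁ ⊕ ι₂) (ι₁ ⊕ ι₂) ℚ).toBlocks₂₂)
    (hfs : Surjective f) (A : hodgeGroupLieRat Φ₁) :
    A ∈ LieIdeal.map f g.ker ↔ fromBlocks (A : Matrix ι₁ ι₁ ℚ) 0 0 (0 : Matrix ι₂ ι₂ ℚ) ∈ hodgeGroupLieRat (prodPeriod Φ₁ Φ₂) := by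
  rw [GoursatLemma.mem_map_ker_iff f g hfs]
  constructor
  · rintro ⟨C, hgC, hfC⟩
    have h₂ : (C : Matrix (ι₁ ⊕ ι₂) (ι₁ ⊕ ι₂) ℚ).toBlocks₂₂ = 0 := by
      rw [← hg C, hgC]; rfl
    have h₁ : (C : Matrix (ι₁ ⊕ ι₂) (ι₁ ⊕ ι₂) ℚ).toBlocks₁₁ = A := by
      rw [← hf C, hfC]
    have hC := eq_fromBlocks_of_mem_hodgeGroupLieRat_prod Φ₁ Φ₂ C.2
    rw [h₁, h₂] at hC
    rw [← hC]
    exact C.2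
  · intro h
    refine ⟨⟨_, h⟩, Subtype.ext ?_, Subtype.ext ?_⟩
    · rw [hg]; exact toBlocks_fromBlocks₂₂ _ _ _ _
    · rw [hf]; exact toBlocks_fromBlocks₁₁ _ _ _ _

variable {Φ₁ Φ₂} in
/-- The Goursat ideal `𝔫₂ = r₂(ker r₁) ⊆ 𝒜(X₂)` has carrier `{B | (0 0; 0 B) ∈ 𝒜(X₁ × X₂)}`. [cite: Gordon1997, §2.16 Proposition]
[cite: MoonenZarhin1999LowDim, §3 (3.1)] -/
private theorem mem_map_ker_iff_zero_fromBlocks_mem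
    {f : hodgeGroupLieRat (prodPeriod Φ₁ Φ₂) →ₗ⁅ℚ⁆ hodgeGroupLieRat Φ₁}
    {g : hodgeGroupLieRat (prodPeriod Φ₁ Φ₂) →ₗ⁅ℚ⁆ hodgeGroupLieRat Φ₂}
    (hf : ∀ C, ((f C : hodgeGroupLieRat Φ₁) : Matrix ι₁ ι₁ ℚ) = (C : Matrix (ι₁ ⊕ ι₂) (ι₁ ⊕ ι₂) ℚ).toBlocks₁₁)
    (hg : ∀ C, ((g C : hodgeGroupLieRat Φ₂) : Matrix ι₂ ι₂ ℚ) = (C : Matrix (ι₁ ⊕ ι₂) (ι₁ ⊕ ι₂) ℚ).toBlocks₂₂)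
    (hgs : Surjective g) (B : hodgeGroupLieRat Φ₂) :
    B ∈ LieIdeal.map g f.ker ↔ fromBlocks (0 : Matrix ι₁ ι₁ ℚ) 0 0 (B : Matrix ι₂ ι₂ ℚ) ∈ hodgeGroupLieRat (prodPeriod Φ₁ Φ₂) := by
  rw [GoursatLemma.mem_map_ker_iff g f hgs]
  constructor
  · rintro ⟨C, hfC, hgC⟩
    have h₁ : (C : Matrix (ι₁ ⊕ ι₂) (ι₁ ⊕ ι₂) ℚ).toBlocks₁₁ = 0 := by
      rw [← hf C, hfC]; rfl
    have h₂ : (C : Matrix (ι₁ ⊕ ι₂) (ι₁ ⊕ ι₂) ℚ).toBlocks₂₂ = B := by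
      rw [← hg C, hgC]
    have hC := eq_fromBlocks_of_mem_hodgeGroupLieRat_prod Φ₁ Φ₂ C.2
    rw [h₁, h₂] at hC
    rw [← hC]
    exact C.2
  · intro h
    refine ⟨⟨_, h⟩, Subtype.ext ?_, Subtype.ext ?_⟩
    · rw [hf]; exact toBlocks_fromBlocks₁₁ _ _ _ _
    · rw [hg]; exact toBlocks_fromBlocks₂₂ _ _ _ _

/-- **MOONEN–ZARHIN (3.1) OVER `ℚ`.**  There are ideals `N₁ ⊆ 𝒜(X₁)`, `N₂ ⊆ 𝒜(X₂)` of the RATIONAL Hodge Lie algebras (`𝔤₁`, `𝔤₂`)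
with carriers `{A | (A 0; 0 0) ∈ 𝒜(X₁ × X₂)}`, `{B | (0 0; 0 B) ∈ 𝒜(X₁ × X₂)}` — equivalently the rational points of `Lie K₁`,
`Lie K₂` —, an isomorphism of `ℚ`-Lie algebras `𝒜(X₁) ⧸ N₁ ≅ 𝒜(X₂) ⧸ N₂` (`𝔤₃`, Goursat's lemma for the block projections over
`ℚ`), `dim_ℚ Nᵢ = dim Kᵢ°`, and `dim_ℚ 𝒜(X₁ × X₂) = dim_ℚ 𝒜(X₁) + dim_ℚ N₂ = dim_ℚ 𝒜(X₂) + dim_ℚ N₁`.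
[cite: MoonenZarhin1999LowDim, §3 (3.1)] [cite: Gordon1997, §2.16 Proposition] [cite: Hazama1983, Lemma (3.1)]
[cite: Springer1998, 4.4.5–4.4.7 and §11.1.2 (a)] -/
theorem exists_lieIdeal_rat_lieEquiv_quotient :
    ∃ (N₁ : LieIdeal ℚ (hodgeGroupLieRat Φ₁)) (N₂ : LieIdeal ℚ (hodgeGroupLieRat Φ₂)),
      (∀ A : hodgeGroupLieRat Φ₁, A ∈ N₁ ↔
        fromBlocks (A : Matrix ι₁ ι₁ ℚ) 0 0 (0 : Matrix ι₂ ι₂ ℚ) ∈ hodgeGroupLieRat (prodPeriod Φ₁ Φ₂)) ∧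
      (∀ B : hodgeGroupLieRat Φ₂, B ∈ N₂ ↔
        fromBlocks (0 : Matrix ι₁ ι₁ ℚ) 0 0 (B : Matrix ι₂ ι₂ ℚ) ∈ hodgeGroupLieRat (prodPeriod Φ₁ Φ₂)) ∧
      (∀ A : hodgeGroupLieRat Φ₁, A ∈ N₁ ↔
        (A : Matrix ι₁ ι₁ ℚ).map ((↑) : ℚ → ℂ) ∈ lieAlgebraGL ((hodgeGroupCProdInl Φ₁ Φ₂).map Matrix.SpecialLinearGroup.toGL)) ∧
      (∀ B : hodgeGroupLieRat Φ₂, B ∈ N₂ ↔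
        (B : Matrix ι₂ ι₂ ℚ).map ((↑) : ℚ → ℂ) ∈ lieAlgebraGL ((hodgeGroupCProdInr Φ₁ Φ₂).map Matrix.SpecialLinearGroup.toGL)) ∧
      Nonempty ((hodgeGroupLieRat Φ₁ ⧸ N₁) ≃ₗ⁅ℚ⁆ (hodgeGroupLieRat Φ₂ ⧸ N₂)) ∧
      finrank ℚ N₁ = (isZConnected_identityComponent (isAlgebraicSubgroup_map_toGL_hodgeGroupCProdInl Φ₁ Φ₂)).zdim ∧
      finrank ℚ N₂ = (isZConnected_identityComponent (isAlgebraicSubgroup_map_toGL_hodgeGroupCProdInr Φ₁ Φ₂)).zdim ∧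
      finrank ℚ (hodgeGroupLieRat (prodPeriod Φ₁ Φ₂)) = finrank ℚ (hodgeGroupLieRat Φ₁) + finrank ℚ N₂ ∧
      finrank ℚ (hodgeGroupLieRat (prodPeriod Φ₁ Φ₂)) = finrank ℚ (hodgeGroupLieRat Φ₂) + finrank ℚ N₁ := by
  obtain ⟨f, g, hf, hg, hfs, hgs, hker⟩ := exists_lieHom_toBlocks_rat Φ₁ Φ₂
  haveI := finite_hodgeGroupLieRat (prodPeriod Φ₁ Φ₂)
  haveI := finite_hodgeGroupLieRat Φ₁
  haveI := finite_hodgeGroupLieRat Φ₂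
  have hN₁ := mem_map_ker_iff_fromBlocks_zero_mem hf hg hfs
  have hN₂ := mem_map_ker_iff_zero_fromBlocks_mem hf hg hgs
  -- dimensions: `dim_ℚ 𝒜 = dim Hg` three times, Goursat twice, the product formula twice
  have e₀ := finrank_hodgeGroupLieRat_eq_zdim (prodPeriod Φ₁ Φ₂)
  have e₁ := finrank_hodgeGroupLieRat_eq_zdim Φ₁
  have e₂ := finrank_hodgeGroupLieRat_eq_zdim Φ₂
  have h₁ := GoursatLemma.finrank_eq_finrank_map_ker_add f g hfs hgs hker
  have h₂ := GoursatLemma.finrank_eq_finrank_map_ker_add' f g hfs hgs hker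
  have d₁ := zdim_map_toGL_hodgeGroupC_prod_eq_add_zdim_identityComponent_hodgeGroupCProdInl Φ₁ Φ₂
  have d₂ := zdim_map_toGL_hodgeGroupC_prod_eq_add_zdim_identityComponent_hodgeGroupCProdInr Φ₁ Φ₂
  refine ⟨LieIdeal.map f g.ker, LieIdeal.map g f.ker, hN₁, hN₂, fun A ↦ ?_, fun B ↦ ?_,
    GoursatLemma.nonempty_lieEquiv_quotient f g hfs hgs, ?_, ?_, ?_, ?_⟩
  · rw [hN₁, fromBlocks_mem_hodgeGroupLieRat_prod_zero_iff]
  · rw [hN₂, fromBlocks_zero_mem_hodgeGroupLieRat_prod_iff]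
  · omega
  · omega
  · omega
  · omega

end Kernels

/-! ### §4 `𝒜(X₁ × X₂) = 𝒜(X₁) ⊕ 𝒜(X₂)` over `ℚ` ⟺ `Hg(X₁ × X₂) = Hg(X₁) × Hg(X₂)` -/

section Splitting

variable {ι₁ ι₂ : Type*} [Fintype ι₁] [Fintype ι₂] [DecidableEq ι₁] [DecidableEq ι₂]
  {E₁ E₂ : Type*} [NormedAddCommGroup E₁] [NormedSpace ℂ E₁] [NormedAddCommGroup E₂] [NormedSpace ℂ E₂]
  (Φ₁ : (ι₁ → ℝ) ≃L[ℝ] E₁) (Φ₂ : (ι₂ → ℝ) ≃L[ℝ] E₂)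

/-- **`dim_ℚ 𝒜(X₁ × X₂) = dim_ℚ 𝒜(X₁) + dim_ℚ 𝒜(X₂) ⟺ Hg(X₁ × X₂)(ℂ) = Hg(X₁)(ℂ) × Hg(X₂)(ℂ)`** (the dimension criterion of
g38-#3, read on the rational Hodge Lie algebras). [cite: Hazama1983, Lemma (3.1)] [cite: MoonenZarhin1999LowDim, §3 (3.1)]
[cite: Springer1998, 4.4.5–4.4.7] -/
theorem finrank_hodgeGroupLieRat_prod_eq_add_iff :
    finrank ℚ (hodgeGroupLieRat (prodPeriod Φ₁ Φ₂)) = finrank ℚ (hodgeGroupLieRat Φ₁) + finrank ℚ (hodgeGroupLieRat Φ₂) ↔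
      hodgeGroupC (prodPeriod Φ₁ Φ₂) = blockDiagProd (hodgeGroupC Φ₁) (hodgeGroupC Φ₂) := by
  rw [finrank_hodgeGroupLieRat_eq_zdim, finrank_hodgeGroupLieRat_eq_zdim, finrank_hodgeGroupLieRat_eq_zdim,
    hodgeGroupC_prod_eq_blockDiagProd_iff_zdim_eq_add]

/-- `dim_ℚ 𝒜(X₁ × X₂) < dim_ℚ 𝒜(X₁) + dim_ℚ 𝒜(X₂) ⟺ Hg(X₁ × X₂)(ℂ) ≠ Hg(X₁)(ℂ) × Hg(X₂)(ℂ)`.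
[cite: Hazama1983, Lemma (3.1)] [cite: GreenGriffithsKerr2012, §III.B (i) ("in general not isomorphisms")] -/
theorem finrank_hodgeGroupLieRat_prod_lt_add_iff :
    finrank ℚ (hodgeGroupLieRat (prodPeriod Φ₁ Φ₂)) < finrank ℚ (hodgeGroupLieRat Φ₁) + finrank ℚ (hodgeGroupLieRat Φ₂) ↔
      hodgeGroupC (prodPeriod Φ₁ Φ₂) ≠ blockDiagProd (hodgeGroupC Φ₁) (hodgeGroupC Φ₂) := by
  rw [Ne, ← finrank_hodgeGroupLieRat_prod_eq_add_iff]
  exact (finrank_hodgeGroupLieRat_prod_le Φ₁ Φ₂).lt_iff_ne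

/-- **SPLITTING IS TESTED ON `𝒜(X₁)`**: `Hg(X₁ × X₂)(ℂ) = Hg(X₁)(ℂ) × Hg(X₂)(ℂ) ⟺ (A 0; 0 0) ∈ 𝒜(X₁ × X₂)` for every `A ∈ 𝒜(X₁)`
(`𝔤₁ = 𝒜(X₁)`, i.e. `Hg(X₁) × 1 ⊆ Hg(X₁ × X₂)` infinitesimally over `ℚ`). [cite: Gordon1997, §2.16 Proposition] [cite: Hazama1983, Lemma (3.1)]
[cite: MoonenZarhin1999LowDim, §3 (3.1)] -/
theorem hodgeGroupC_prod_eq_blockDiagProd_iff_forall_fromBlocks_zero_mem :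
    hodgeGroupC (prodPeriod Φ₁ Φ₂) = blockDiagProd (hodgeGroupC Φ₁) (hodgeGroupC Φ₂) ↔
      ∀ A ∈ hodgeGroupLieRat Φ₁, fromBlocks A 0 0 (0 : Matrix ι₂ ι₂ ℚ) ∈ hodgeGroupLieRat (prodPeriod Φ₁ Φ₂) := by
  obtain ⟨f, g, hf, hg, hfs, hgs, hker⟩ := exists_lieHom_toBlocks_rat Φ₁ Φ₂
  haveI := finite_hodgeGroupLieRat (prodPeriod Φ₁ Φ₂)
  haveI := finite_hodgeGroupLieRat Φ₁
  haveI := finite_hodgeGroupLieRat Φ₂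
  rw [← finrank_hodgeGroupLieRat_prod_eq_add_iff, GoursatLemma.finrank_eq_add_iff_map_ker_eq_top f g hfs hgs hker,
    eq_top_iff]
  constructor
  · intro h A hA
    exact (mem_map_ker_iff_fromBlocks_zero_mem hf hg hfs ⟨A, hA⟩).1 (h (LieSubmodule.mem_top _))
  · intro h A _
    exact (mem_map_ker_iff_fromBlocks_zero_mem hf hg hfs A).2 (h A.1 A.2)

/-- **SPLITTING IS TESTED ON `𝒜(X₂)`**: `Hg(X₁ × X₂)(ℂ) = Hg(X₁)(ℂ) × Hg(X₂)(ℂ) ⟺ (0 0; 0 B) ∈ 𝒜(X₁ × X₂)` for every `B ∈ 𝒜(X₂)`.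
[cite: Gordon1997, §2.16 Proposition] [cite: Hazama1983, Lemma (3.1)] [cite: MoonenZarhin1999LowDim, §3 (3.1)] -/
theorem hodgeGroupC_prod_eq_blockDiagProd_iff_forall_zero_fromBlocks_mem :
    hodgeGroupC (prodPeriod Φ₁ Φ₂) = blockDiagProd (hodgeGroupC Φ₁) (hodgeGroupC Φ₂) ↔
      ∀ B ∈ hodgeGroupLieRat Φ₂, fromBlocks (0 : Matrix ι₁ ι₁ ℚ) 0 0 B ∈ hodgeGroupLieRat (prodPeriod Φ₁ Φ₂) := by
  obtain ⟨f, g, hf, hg, hfs, hgs, hker⟩ := exists_lieHom_toBlocks_rat Φ₁ Φ₂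
  haveI := finite_hodgeGroupLieRat (prodPeriod Φ₁ Φ₂)
  haveI := finite_hodgeGroupLieRat Φ₁
  haveI := finite_hodgeGroupLieRat Φ₂
  have hker' : g.ker ⊓ f.ker = ⊥ := by rw [inf_comm, hker]
  rw [← finrank_hodgeGroupLieRat_prod_eq_add_iff, add_comm, GoursatLemma.finrank_eq_add_iff_map_ker_eq_top g f hgs hfs hker',
    eq_top_iff]
  constructor
  · intro h B hB
    exact (mem_map_ker_iff_zero_fromBlocks_mem hf hg hgs ⟨B, hB⟩).1 (h (LieSubmodule.mem_top _))
  · intro h B _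
    exact (mem_map_ker_iff_zero_fromBlocks_mem hf hg hgs B).2 (h B.1 B.2)

/-- **`Hg(X₁ × X₂) = Hg(X₁) × Hg(X₂) ⟺ 𝒜(X₁ × X₂) = 𝒜(X₁) ⊕ 𝒜(X₂)`**: the complex Hodge group of the product is the product of
the Hodge groups iff `(A 0; 0 B) ∈ 𝒜(X₁ × X₂)` for all `A ∈ 𝒜(X₁)`, `B ∈ 𝒜(X₂)` (GGK's inclusion III.B (i) is an equality).
[cite: GreenGriffithsKerr2012, §III.B (i)] [cite: MoonenZarhin1999LowDim, §3 (3.1)] [cite: Hazama1983, Lemma (3.1)] -/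
theorem hodgeGroupC_prod_eq_blockDiagProd_iff_forall_fromBlocks_mem_hodgeGroupLieRat :
    hodgeGroupC (prodPeriod Φ₁ Φ₂) = blockDiagProd (hodgeGroupC Φ₁) (hodgeGroupC Φ₂) ↔
      ∀ A ∈ hodgeGroupLieRat Φ₁, ∀ B ∈ hodgeGroupLieRat Φ₂, fromBlocks A 0 0 B ∈ hodgeGroupLieRat (prodPeriod Φ₁ Φ₂) := by
  constructor
  · intro h A hA B hB
    rw [fromBlocks_diag_eq_add]
    exact add_mem ((hodgeGroupC_prod_eq_blockDiagProd_iff_forall_fromBlocks_zero_mem Φ₁ Φ₂).1 h A hA)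
      ((hodgeGroupC_prod_eq_blockDiagProd_iff_forall_zero_fromBlocks_mem Φ₁ Φ₂).1 h B hB)
  · intro h
    exact (hodgeGroupC_prod_eq_blockDiagProd_iff_forall_fromBlocks_zero_mem Φ₁ Φ₂).2 fun A hA ↦ h A hA 0 (zero_mem _)

/-- The same as an identity of sets of rational matrices: `𝒜(X₁ × X₂) = {(A 0; 0 B) | A ∈ 𝒜(X₁), B ∈ 𝒜(X₂)}` iff the groups split.
[cite: GreenGriffithsKerr2012, §III.B (i)] [cite: MoonenZarhin1999LowDim, §3 (3.1)] -/
theorem hodgeGroupC_prod_eq_blockDiagProd_iff_coe_hodgeGroupLieRat_prod_eq_image :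
    hodgeGroupC (prodPeriod Φ₁ Φ₂) = blockDiagProd (hodgeGroupC Φ₁) (hodgeGroupC Φ₂) ↔
      (hodgeGroupLieRat (prodPeriod Φ₁ Φ₂) : Set (Matrix (ι₁ ⊕ ι₂) (ι₁ ⊕ ι₂) ℚ)) =
        (fun AB : Matrix ι₁ ι₁ ℚ × Matrix ι₂ ι₂ ℚ ↦ fromBlocks AB.1 0 0 AB.2) ''
          ((hodgeGroupLieRat Φ₁ : Set (Matrix ι₁ ι₁ ℚ)) ×ˢ (hodgeGroupLieRat Φ₂ : Set (Matrix ι₂ ι₂ ℚ))) := by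
  rw [hodgeGroupC_prod_eq_blockDiagProd_iff_forall_fromBlocks_mem_hodgeGroupLieRat]
  constructor
  · intro h
    refine Set.Subset.antisymm (coe_hodgeGroupLieRat_prod_subset Φ₁ Φ₂) ?_
    rintro _ ⟨⟨A, B⟩, ⟨hA, hB⟩, rfl⟩
    exact h A hA B hB
  · intro h A hA B hB
    rw [← SetLike.mem_coe, h]
    exact ⟨(A, B), Set.mk_mem_prod hA hB, rfl⟩

/-- Real points: `𝒜(X₁ × X₂) = 𝒜(X₁) ⊕ 𝒜(X₂) ⟹ Hg(X₁ × X₂)(ℝ) = Hg(X₁)(ℝ) × Hg(X₂)(ℝ)`. [cite: MoonenZarhin1999LowDim, §3 (3.1)]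
[cite: GreenGriffithsKerr2012, §III.B (i)] -/
theorem hodgeGroup_prod_eq_of_forall_fromBlocks_mem_hodgeGroupLieRat
    (h : ∀ A ∈ hodgeGroupLieRat Φ₁, ∀ B ∈ hodgeGroupLieRat Φ₂, fromBlocks A 0 0 B ∈ hodgeGroupLieRat (prodPeriod Φ₁ Φ₂)) :
    hodgeGroup (prodPeriod Φ₁ Φ₂) = ((hodgeGroup Φ₁).prod (hodgeGroup Φ₂)).map (blockDiag ι₁ ι₂) :=
  hodgeGroup_prod_eq_of_hodgeGroupC_prod_eq
    ((hodgeGroupC_prod_eq_blockDiagProd_iff_forall_fromBlocks_mem_hodgeGroupLieRat Φ₁ Φ₂).2 h)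

end Splitting

end ComplexTorus

end Literature.Geometry.Kaehler
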